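import Literature.NumberTheory.EllipticCurves.KummerImageIsotropy
import Literature.NumberTheory.EllipticCurves.ArchimedeanWeilPairingDuality
import Literature.NumberTheory.EllipticCurves.WeilPairingProofs
import Literature.NumberTheory.EllipticCurves.GaloisActionProofs
import Literature.NumberTheory.GaloisRepresentations.ArchimedeanLocalDuality
import Literature.NumberTheory.GaloisRepresentations.LocalGlobalCohomologyDualityProofs
import Literature.NumberTheory.GaloisCohomology.ArchimedeanInvariantMap
import HarnessLib

/-!
# P412 in the kernel, IV — the REAL PLACE: an element of `Γ_K` coming from a real completion fixes at most
# `2·m` points of `E[m]` (the growth `#H⁰(ℝ, E[p^k]) ≍ p^k` of Greenberg's `δ = Σ_{v ∣ ∞} [F_v : ℝ]`)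

Cell `bsd-2adic` (run/shared/lean/pub/bsd-2adic/), seat `bsd-2adic-t42` GEN 20 (pen RC-315 (b): discharge of the PRINT
binder P412 = `Greenberg1999.prop412_noFiniteSubmodule_H1Sigma_of_rank_one`). HONEST FRAMING: research route;
THEOREMS ONLY (no `def`, no named fact, no instance, no `sorry`); nothing booked; BSD is not proved by any of this.
PARTITION: K4 PRINT binder P412 × all p — reduces-the-named-input-of; bears_on K4 19097
(`--supports stmt-BirchSwinnertonDyer-19097`).

## What (Greenberg LNM 1716 p. 114: «`δ = Σ_{v∣∞} [F_v : ℝ]` … `−δ` is the Euler characteristic»; Tate's global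
## Euler characteristic carries the factor `#H⁰(F_v, M)` at each real `v`, Milne I Thm. 5.1)

For a number field `K`, an elliptic `W/K`, an infinite place `w`, a NON-TRIVIAL `σ ∈ Γ_{K_w}` (which exists iff `w`
is real, `exists_ne_one_absoluteGaloisGroup_of_isReal`) and `c = σ|_{K̄} ∈ Γ_K` (`absGaloisRestrict`), and every `m ≥ 2`:

  **`natCard_fixedBy_le_two_mul`**: `#{T ∈ E[m] : c • T = T} ≤ 2·m`.

Proof (no Lie theory of `E(ℝ)`, no structure of `E[m]`): let `V = E[m]` (order `m²`, `card_torsionPoints_eq_sq_holds`),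
`H = V^{c}`, `I = (1 + c)V ⊆ H`. The Weil pairing `e_m` (tree theorem `exists_weilPairing_holds`) is `Γ_K`-equivariant
and `c` inverts `m`-th roots of unity (`absGaloisRestrict_smul_eq_inv_of_pow_eq_one_infinitePlace`), so
`e(cS, cT) = e(S,T)⁻¹`; hence `H` annihilates `I`: for `S ∈ H`, `e(S, T + cT) = e(S,T)·e(cS,cT) = 1`. Non-degeneracy
in the first variable (`weilPairingHom_injective`) embeds the annihilator of `I` into `Hom(V/I, μ_m)`, of order `#(V/I)`
(`Nat.card_addMonoidHom_zmod` via `μ_m ≃ ℤ/m`), so `#H · #I ≤ #V = m²`. Finally `2H ⊆ I` and the kernel of `2·` on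
`H` lies in `E[2]` (order `4`), so `#H ≤ 4·#I`, whence `#H² ≤ 4m²`.

References: [GreenbergLNM1716] §4 p. 114; [MilneADT2006] I Thm. 5.1, I Thm. 2.13; [SilvermanAEC2009] III.8.1.
-/

set_option autoImplicit false
set_option linter.dupNamespace false

noncomputable section

open scoped Classical AddSubgroup

namespace Summit.BirchSwinnertonDyer.BirchSwinnertonDyer.Theorems.P412Kernel

open NumberField Field WeierstrassCurve
  Literature.NumberTheory.EllipticCurves Literature.NumberTheory.GaloisRepresentations
  Literature.NumberTheory.GaloisRepresentations.DiscreteGaloisModule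
  Literature.NumberTheory.GaloisCohomology

universe u

variable {K : Type u} [Field K] [NumberField K] (W : WeierstrassCurve K) [W.IsElliptic]

omit [NumberField K] in
/-- `σ² = 1` in `Γ_{K_w}` (a group of order `≤ 2`). [cite: SerreGaloisCohomology1997, I §2.4] -/
theorem sq_eq_one_absoluteGaloisGroup_completion (w : InfinitePlace K)
    (σ : absoluteGaloisGroup w.Completion) : σ * σ = 1 := by
  haveI := finite_absoluteGaloisGroup_completion_infinitePlace w
  have hcard := natCard_absoluteGaloisGroup_completion_infinitePlace_le_two w
  have hdvd : orderOf σ ∣ Nat.card (absoluteGaloisGroup w.Completion) := orderOf_dvd_natCard σ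
  have hpos : 0 < Nat.card (absoluteGaloisGroup w.Completion) := Nat.card_pos
  have h2 : σ ^ 2 = 1 := by
    interval_cases h : Nat.card (absoluteGaloisGroup w.Completion)
    · have h1 : orderOf σ = 1 := Nat.dvd_one.mp hdvd
      rw [orderOf_eq_one_iff] at h1
      rw [h1, one_pow]
    · exact orderOf_dvd_iff_pow_eq_one.mp hdvd
  rwa [pow_two] at h2

/-- **`#E[m]^{c} ≤ 2m` for an element `c ∈ Γ_K` induced by a non-trivial element of a (real) archimedean
decomposition group.** See the module docstring for the proof via the Weil pairing.
[cite: GreenbergLNM1716, §4 p. 114] [cite: MilneADT2006, I Thm. 5.1 (footnote 13) and I Thm. 2.13]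
[cite: SilvermanAEC2009, Prop. III.8.1] -/
theorem natCard_fixedBy_le_two_mul (w : InfinitePlace K) {σ : absoluteGaloisGroup w.Completion} (hσ : σ ≠ 1)
    {m : ℕ} (hm : 2 ≤ m) :
    Nat.card {T : W.geomTorsion (m : ℤ) // absGaloisRestrict K w.Completion σ • T = T} ≤ 2 * m := by
  haveI : NeZero m := ⟨by omega⟩
  haveI : Finite (W.geomTorsion (m : ℤ)) := finite_geomTorsion_of_neZero W m
  haveI : Finite (W.geomTorsion ((2 : ℕ) : ℤ)) := finite_geomTorsion_of_neZero W 2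
  set c : absoluteGaloisGroup K := absGaloisRestrict K w.Completion σ with hc
  -- the Weil pairing at level `m`
  obtain ⟨e, hμ, hadd₁, hadd₂, halt, hnd, hgal⟩ :=
    exists_weilPairing_holds W m hm (by exact_mod_cast (show m ≠ 0 by omega))
  set b := weilPairingHom W m e hμ hadd₁ hadd₂ with hb
  have hbinj : Function.Injective b := weilPairingHom_injective W m e hμ hadd₁ hadd₂ halt hnd
  -- `c² = 1` on `E[m]`
  have hcc : ∀ T : W.geomTorsion (m : ℤ), c • c • T = T := fun T ↦ by
    rw [smul_smul, hc, ← map_mul, sq_eq_one_absoluteGaloisGroup_completion w σ, map_one, one_smul]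
  -- `c` inverts the pairing: `b (cS) (cT) = - b S T`
  have hinv : ∀ S T : W.geomTorsion (m : ℤ), b (c • S) (c • T) = -b S T := fun S T ↦ by
    rw [muCarrier_eq_iff, hb, coe_weilPairingHom, ← hgal]
    rw [map_neg, toMul_neg, Subgroup.coe_inv, Units.val_inv_eq_inv_val, coe_weilPairingHom, hc]
    exact absGaloisRestrict_smul_eq_inv_of_pow_eq_one_infinitePlace w hσ (NeZero.ne m) (hμ S T)
  -- the subgroups `H = V^c` and `I = (1 + c) V`
  let γ : W.geomTorsion (m : ℤ) →+ W.geomTorsion (m : ℤ) := DistribSMul.toAddMonoidHom _ c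
  let H : AddSubgroup (W.geomTorsion (m : ℤ)) := (γ - AddMonoidHom.id _).ker
  let I : AddSubgroup (W.geomTorsion (m : ℤ)) := (γ + AddMonoidHom.id _).range
  have hH : ∀ T, T ∈ H ↔ c • T = T := fun T ↦ by
    rw [AddMonoidHom.mem_ker, AddMonoidHom.sub_apply, AddMonoidHom.id_apply, sub_eq_zero]
    rfl
  have hIH : I ≤ H := by
    rintro _ ⟨T, rfl⟩
    rw [hH]
    change c • (c • T + T) = c • T + T
    rw [smul_add, hcc, add_comm]
  -- (b) `H` annihilates `I`
  have hann : ∀ S ∈ H, ∀ T' ∈ I, b S T' = 0 := by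
    rintro S hS _ ⟨T, rfl⟩
    change b S (c • T + T) = 0
    rw [map_add, ← (hH S).mp hS, hinv, (hH S).mp hS, neg_add_cancel]
  -- (d) `#H · #I ≤ #V`: the annihilator of `I` embeds in `Hom(V/I, ℤ/m)`
  have hmV : ∀ T : W.geomTorsion (m : ℤ), m • T = 0 := fun T ↦
    Subtype.ext (by
      rw [AddSubgroupClass.coe_nsmul, ZeroMemClass.coe_zero]
      exact AddSubgroup.torsionBy.nsmul_iff.mp T.2)
  have hmQ : ∀ z : W.geomTorsion (m : ℤ) ⧸ I, m • z = 0 := fun z ↦ by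
    induction z using QuotientAddGroup.induction_on with
    | H T => rw [← QuotientAddGroup.mk_nsmul, hmV, QuotientAddGroup.mk_zero]
  let ε : MuCarrier K m →+ ZMod m := (muCarrierZModEquiv K m).toAddMonoidHom
  have hε : Function.Injective ε := (muCarrierZModEquiv K m).injective
  let φ : H → (W.geomTorsion (m : ℤ) ⧸ I →+ ZMod m) := fun S ↦
    QuotientAddGroup.lift I (ε.comp (b S)) fun T hT ↦ (AddMonoidHom.mem_ker).mpr (by
      rw [AddMonoidHom.comp_apply, hann S S.2 T hT, map_zero])
  have hφ : Function.Injective φ := by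
    intro S S' h
    apply Subtype.ext
    apply hbinj
    refine AddMonoidHom.ext fun T ↦ hε ?_
    have h' := DFunLike.congr_fun h (T : W.geomTorsion (m : ℤ) ⧸ I)
    rwa [QuotientAddGroup.lift_mk, QuotientAddGroup.lift_mk] at h'
  haveI : Finite (W.geomTorsion (m : ℤ) ⧸ I →+ ZMod m) := finite_addMonoidHom_zmod _ m
  have hHI : Nat.card H * Nat.card I ≤ Nat.card (W.geomTorsion (m : ℤ)) := by
    calc Nat.card H * Nat.card I ≤ Nat.card (W.geomTorsion (m : ℤ) ⧸ I) * Nat.card I :=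
          Nat.mul_le_mul_right _ ((Nat.card_le_card_of_injective φ hφ).trans_eq (Nat.card_addMonoidHom_zmod hmQ))
      _ = Nat.card (W.geomTorsion (m : ℤ)) := (AddSubgroup.card_eq_card_quotient_mul_card_addSubgroup I).symm
  -- (e) `#H ≤ 4 · #I`: `T ↦ T + cT = 2T` maps `H` into `I` with kernel inside `E[2]`
  let ψ : H →+ I := ((γ + AddMonoidHom.id _).comp H.subtype).codRestrict I fun S ↦ ⟨S, rfl⟩
  have hker : Nat.card ψ.ker ≤ 4 := by
    have h2 : Nat.card (W.geomTorsion ((2 : ℕ) : ℤ)) = 2 ^ 2 :=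
      card_torsionPoints_eq_sq_holds W (AlgebraicClosure K) (by norm_num)
    rw [← show (2 : ℕ) ^ 2 = 4 by norm_num, ← h2]
    refine Nat.card_le_card_of_injective
      (fun S : ψ.ker ↦ (⟨((S : H) : W.geomTorsion (m : ℤ)), ?_⟩ : W.geomTorsion ((2 : ℕ) : ℤ))) ?_
    · have hS0 : γ ((S : H) : W.geomTorsion (m : ℤ)) + ((S : H) : W.geomTorsion (m : ℤ)) = 0 := by
        have := (AddMonoidHom.mem_ker).mp S.2
        exact congrArg Subtype.val this
      have hcS : c • ((S : H) : W.geomTorsion (m : ℤ)) = (S : H) := (hH _).mp (S : H).2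
      have h2S : 2 • ((S : H) : W.geomTorsion (m : ℤ)) = 0 := by
        rw [two_nsmul]
        have h' : c • ((S : H) : W.geomTorsion (m : ℤ)) + (S : H) = 0 := hS0
        rwa [hcS] at h'
      rw [AddSubgroup.torsionBy.nsmul_iff, ← AddSubgroupClass.coe_nsmul, h2S, ZeroMemClass.coe_zero]
    · intro S S' h
      have h1 := congrArg Subtype.val h
      exact Subtype.ext (Subtype.ext (Subtype.ext h1))
  have hHle : Nat.card H ≤ 4 * Nat.card I := by
    have hrange : Nat.card ψ.range ≤ Nat.card I :=
      Nat.card_le_card_of_injective (fun z : ψ.range ↦ (z : I)) Subtype.val_injective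
    calc Nat.card H = Nat.card (H ⧸ ψ.ker) * Nat.card ψ.ker :=
          AddSubgroup.card_eq_card_quotient_mul_card_addSubgroup ψ.ker
      _ = Nat.card ψ.range * Nat.card ψ.ker := by
          rw [Nat.card_congr (QuotientAddGroup.quotientKerEquivRange ψ).toEquiv]
      _ ≤ Nat.card I * 4 := Nat.mul_le_mul hrange hker
      _ = 4 * Nat.card I := mul_comm _ _
  -- (f) count: `#H² ≤ 4 · #H · #I ≤ 4 m²`
  have hV : Nat.card (W.geomTorsion (m : ℤ)) = m ^ 2 :=
    card_torsionPoints_eq_sq_holds W (AlgebraicClosure K) (by exact_mod_cast (show m ≠ 0 by omega))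
  have hfix : Nat.card {T : W.geomTorsion (m : ℤ) // c • T = T} = Nat.card H :=
    Nat.card_congr (Equiv.subtypeEquivRight fun T ↦ (hH T).symm)
  rw [hfix]
  have hsq : Nat.card H * Nat.card H ≤ (2 * m) * (2 * m) :=
    calc Nat.card H * Nat.card H ≤ Nat.card H * (4 * Nat.card I) := Nat.mul_le_mul_left _ hHle
      _ = 4 * (Nat.card H * Nat.card I) := by ring
      _ ≤ 4 * Nat.card (W.geomTorsion (m : ℤ)) := Nat.mul_le_mul_left _ hHI
      _ = (2 * m) * (2 * m) := by rw [hV]; ring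
  exact Nat.mul_self_le_mul_self_iff.mp hsq

end Summit.BirchSwinnertonDyer.BirchSwinnertonDyer.Theorems.P412Kernel

end
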